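import Literature.NumberTheory.Automorphic.ParabolicGLBigCell
import Literature.NumberTheory.Automorphic.UnitaryGroupLocalFactors
import Literature.NumberTheory.Automorphic.AdicCompletionLocalField
import HarnessLib

/-!
# Congruence boxes in `GL_N(Π_{w ∣ v} E_w)`: neighbourhood basis, two-factor Iwahori factorisation `K = (B ∩ K)(N̄ ∩ K)`,
# and the long Weyl element against the big cell `B N̄`

Topic `NumberTheory/Automorphic`; namespace `Literature.NumberTheory.Automorphic.UnitaryGroup`.  THEOREMS ONLY (no definition, no
named fact, no `sorry`, no instance, no notation).  Registry pub/hodgecm-mathlib F0∕P3, node N1 of `F0_P3_KeysCaseTwoPaydown` (★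
`U3PrincipalSeriesJacquetFiltration`, [Casselman1995, Lemma 7.1.1 (a)]): the group-theoretic input of the OPEN-CELL STANDARD SECTION of
`i_G(χ)` (sequel `CMPrincipalSeriesOpenCellSection`), hence of the lower bound «`ℓ ≠ 0`».

`E/F` number fields, `v` a finite place of `F`, `E_v := E ⊗_F F_v = Π_{w ∣ v} E_w` (★ `UnitaryGroup.LocalRing E v`), `GL_N(E_v) ≃ₜ* Π_w GL_N(E_w)`
(★ `localGLPiEquiv`).  A **congruence box** is the set of `g` whose `w`-components lie in principal congruence subgroups
`K_{γ_w} ≤ GL_N(E_w)` (★ `congruenceGL`), `0 < γ_w < 1`; no name is introduced for it — the hypothesis is spelled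
`∀ w, localGLPiEquiv E N v g w ∈ congruenceGL N (γ w)`.

* §1 componentwise criteria: `g` is upper triangular ∕ lower unitriangular in `GL_N(E_v)` iff every component is (entries are evaluated
  componentwise, ★ `GLn.coe_piEquiv_apply`).
* §2 **two-factor Iwahori factorisation of a congruence box**: every `k` in the box is `k = p u`, `p` upper triangular, `u` lower unitriangular,
  both in the box — ★ `exists_parabolic_mul_lower_of_mem_congruenceGL` ([Casselman1995, Prop. 1.4.4]; [BernsteinZelevinsky1976, §3.13]) in
  every factor `GL_N(E_w)`, reassembled through `localGLPiEquiv`.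
* §3 **the key consequence**: a lower unitriangular `m` of the form `m = b κ` (`b` upper triangular, `κ` in the box) lies in the box
  (`B ∩ N̄ = 1`, ★ `eq_one_of_mem_standardParabolicGL_of_mem_lower`).
* §4 congruence boxes are compact, open, and form a neighbourhood basis of `1` in `GL_N(E_v)` (★ `exists_congruenceGL_pow_subset`,
  ★ `isCompact_congruenceGL`, ★ `isOpen_congruenceGL`, per factor).
* §5 the long Weyl element (any `w` with matrix `Φ_N = antidiag(1,…,1)`, ★ `StdForm.antidiagonal`, over any commutative ring): `w² = 1`,
  `w u w` is lower unitriangular for `u` upper unitriangular, and `w ∉ B N̄` for `N ≥ 2` (the `(N,N)` entry of `b m` is `b_{NN} ≠ 0`).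

## References
* [Casselman1995] W. Casselman, *Introduction to the theory of admissible representations of `p`-adic reductive groups* (1995),
  Prop. 1.4.4 (Iwahori factorisation), §6.3.
* [BernsteinZelevinsky1976] I. N. Bernstein, A. V. Zelevinsky, *Representations of the group `GL(n,F)`*, Russian Math. Surveys 31:3
  (1976), §3.13.
* [PlatonovRapinchuk1994] V. Platonov, A. Rapinchuk, *Algebraic Groups and Number Theory* (1994), §3.3 (topology of `G(F_v)`), §5.1.
* [Rogawski1990] J. Rogawski, Ann. of Math. Stud. 123 (1990), §1.10 p. 9 (the Borel pair and the long Weyl element of `U(Φ_N)`).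
-/

set_option autoImplicit false

noncomputable section

open scoped MatrixGroups
open Topology Matrix OrderDual

namespace Literature.NumberTheory.Automorphic

namespace UnitaryGroup

section Local

open _root_.NumberField _root_.IsDedekindDomain

variable {F : Type} [Field F] [NumberField F] (E : Type) [Field E] [NumberField E] [Algebra F E]
  (N : ℕ) (v : HeightOneSpectrum (𝓞 F))

/-! ## §1 Upper triangular ∕ lower unitriangular: componentwise -/

omit [NumberField F] in
/-- entries of the `w`-component: `(g_w)_{ij} = (g_{ij})_w`. [cite: PlatonovRapinchuk1994, §5.1] -/
theorem localGLPiEquiv_apply_apply (g : GL (Fin N) (LocalRing E v)) (w : PlacesOver E v) (i j : Fin N) :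
    ((localGLPiEquiv E N v g w : GL (Fin N) (w.1.adicCompletion E)) : Matrix (Fin N) (Fin N) (w.1.adicCompletion E)) i j =
      ((g : GL (Fin N) (LocalRing E v)) : Matrix (Fin N) (Fin N) (LocalRing E v)) i j w := by
  rw [GLn.coe_piEquiv_apply, Matrix.map_apply]
  rfl

omit [NumberField F] in
/-- `g ∈ GL_N(E_v)` is upper triangular iff every component `g_w ∈ GL_N(E_w)` is. [cite: PlatonovRapinchuk1994, §5.1] -/
theorem mem_standardParabolicGL_iff_forall (g : GL (Fin N) (LocalRing E v)) :
    g ∈ standardParabolicGL (LocalRing E v) (_root_.id : Fin N → Fin N) ↔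
      ∀ w : PlacesOver E v, localGLPiEquiv E N v g w ∈ standardParabolicGL (w.1.adicCompletion E) (_root_.id : Fin N → Fin N) := by
  simp only [mem_standardParabolicGL_iff, Matrix.BlockTriangular]
  constructor
  · intro h w i j hij
    rw [localGLPiEquiv_apply_apply, h hij]
    rfl
  · intro h i j hij
    funext w
    have := h w hij
    rw [localGLPiEquiv_apply_apply] at this
    exact this

omit [NumberField F] in
/-- `g ∈ GL_N(E_v)` is lower unitriangular iff every component is. [cite: PlatonovRapinchuk1994, §5.1] -/
theorem mem_lowerUnitriangular_iff_forall (g : GL (Fin N) (LocalRing E v)) :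
    g ∈ unipotentRadicalGL (LocalRing E v) (⇑toDual ∘ (_root_.id : Fin N → Fin N)) ↔
      ∀ w : PlacesOver E v,
        localGLPiEquiv E N v g w ∈ unipotentRadicalGL (w.1.adicCompletion E) (⇑toDual ∘ (_root_.id : Fin N → Fin N)) := by
  simp only [mem_unipotentRadicalGL_iff_apply]
  constructor
  · intro h w i j hij
    rw [localGLPiEquiv_apply_apply, h i j hij, Matrix.one_apply, Matrix.one_apply]
    split_ifs <;> rfl
  · intro h i j hij
    funext w
    have := h w i j hij
    rw [localGLPiEquiv_apply_apply] at this
    rw [this, Matrix.one_apply, Matrix.one_apply]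
    split_ifs <;> rfl

/-! ## §2 The two-factor Iwahori factorisation of a congruence box -/

omit [NumberField F] in
/-- **Iwahori factorisation of a congruence box** `K = (B ∩ K)(N̄ ∩ K)`: if every component of `k ∈ GL_N(E_v)` lies in the principal
congruence subgroup `K_{γ_w}` with `γ_w < 1`, then `k = p u` with `p` upper triangular, `u` lower unitriangular, both with all components in
the `K_{γ_w}` (★ `exists_parabolic_mul_lower_of_mem_congruenceGL` factor by factor). [cite: Casselman1995, Prop. 1.4.4] [cite: BernsteinZelevinsky1976, §3.13] -/
theorem exists_borel_mul_lower_of_forall_mem_congruenceGL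
    (γ : ∀ w : PlacesOver E v, ValuativeRel.ValueGroupWithZero (w.1.adicCompletion E))
    (hγ : ∀ w, γ w < 1) (k : GL (Fin N) (LocalRing E v)) (hk : ∀ w, localGLPiEquiv E N v k w ∈ congruenceGL N (γ w)) :
    ∃ p ∈ standardParabolicGL (LocalRing E v) (_root_.id : Fin N → Fin N), (∀ w, localGLPiEquiv E N v p w ∈ congruenceGL N (γ w)) ∧
      ∃ u ∈ unipotentRadicalGL (LocalRing E v) (⇑toDual ∘ (_root_.id : Fin N → Fin N)),
        (∀ w, localGLPiEquiv E N v u w ∈ congruenceGL N (γ w)) ∧ k = p * u := by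
  choose p hpP hpK u huU huK hku using fun w => exists_parabolic_mul_lower_of_mem_congruenceGL (_root_.id : Fin N → Fin N) (hγ w) (hk w)
  refine ⟨(localGLPiEquiv E N v).symm p, ?_, ?_, (localGLPiEquiv E N v).symm u, ?_, ?_, ?_⟩
  · rw [mem_standardParabolicGL_iff_forall]
    intro w
    rw [ContinuousMulEquiv.apply_symm_apply]
    exact hpP w
  · intro w
    rw [ContinuousMulEquiv.apply_symm_apply]
    exact hpK w
  · rw [mem_lowerUnitriangular_iff_forall]
    intro w
    rw [ContinuousMulEquiv.apply_symm_apply]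
    exact huU w
  · intro w
    rw [ContinuousMulEquiv.apply_symm_apply]
    exact huK w
  · apply (localGLPiEquiv E N v).injective
    rw [map_mul, ContinuousMulEquiv.apply_symm_apply, ContinuousMulEquiv.apply_symm_apply]
    funext w
    exact hku w

/-! ## §3 A lower unitriangular element of `B · K` lies in `K` -/

omit [NumberField F] in
/-- **`N̄ ∩ B·K ⊆ K` for a congruence box `K`**: if `m` is lower unitriangular and `m = b κ` with `b` upper triangular and `κ` in the box
(`γ_w < 1`), then `m` is in the box — write `κ = p u` (§2); then `b p = m u⁻¹ ∈ B ∩ N̄ = 1` (★ `eq_one_of_mem_standardParabolicGL_of_mem_lower`), so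
`m = u`. [cite: Casselman1995, Prop. 1.4.4] [cite: BernsteinZelevinsky1976, §3.13] -/
theorem forall_mem_congruenceGL_of_lower_eq_borel_mul
    (γ : ∀ w : PlacesOver E v, ValuativeRel.ValueGroupWithZero (w.1.adicCompletion E))
    (hγ : ∀ w, γ w < 1) {m b κ : GL (Fin N) (LocalRing E v)}
    (hm : m ∈ unipotentRadicalGL (LocalRing E v) (⇑toDual ∘ (_root_.id : Fin N → Fin N)))
    (hb : b ∈ standardParabolicGL (LocalRing E v) (_root_.id : Fin N → Fin N))
    (hκ : ∀ w, localGLPiEquiv E N v κ w ∈ congruenceGL N (γ w)) (h : m = b * κ) :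
    ∀ w, localGLPiEquiv E N v m w ∈ congruenceGL N (γ w) := by
  obtain ⟨p, hpP, -, u, huU, huK, hpu⟩ := exists_borel_mul_lower_of_forall_mem_congruenceGL E N v γ hγ κ hκ
  have hbp : b * p = m * u⁻¹ := by
    rw [h, hpu, mul_assoc, mul_assoc, mul_inv_cancel, mul_one]
  have h1 : b * p = 1 := eq_one_of_mem_standardParabolicGL_of_mem_lower (_root_.id : Fin N → Fin N)
    (Subgroup.mul_mem _ hb hpP) (by rw [hbp]; exact Subgroup.mul_mem _ hm (Subgroup.inv_mem _ huU))
  have hmu : m = u := by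
    rw [hbp] at h1
    exact (mul_inv_eq_one.1 h1)
  rw [hmu]
  exact huK

/-! ## §4 Congruence boxes: compact, open, a neighbourhood basis of `1` -/

omit [NumberField F] in
/-- a congruence box is the preimage of a product of principal congruence subgroups under `localGLPiEquiv` (plumbing). [cite: PlatonovRapinchuk1994, §5.1] -/
theorem setOf_forall_mem_congruenceGL_eq_preimage
    (γ : ∀ w : PlacesOver E v, ValuativeRel.ValueGroupWithZero (w.1.adicCompletion E)) :
    {g : GL (Fin N) (LocalRing E v) | ∀ w, localGLPiEquiv E N v g w ∈ congruenceGL N (γ w)} =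
      (localGLPiEquiv E N v) ⁻¹' Set.pi Set.univ (fun w => (congruenceGL N (γ w) : Set (GL (Fin N) (w.1.adicCompletion E)))) := by
  ext g
  simp only [Set.mem_setOf_eq, Set.mem_preimage, Set.mem_univ_pi, SetLike.mem_coe]

omit [NumberField F] in
/-- **a congruence box is COMPACT** (each `K_{γ_w}` is, ★ `isCompact_congruenceGL`). [cite: PlatonovRapinchuk1994, §3.3] -/
theorem isCompact_setOf_forall_mem_congruenceGL
    (γ : ∀ w : PlacesOver E v, ValuativeRel.ValueGroupWithZero (w.1.adicCompletion E)) :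
    IsCompact {g : GL (Fin N) (LocalRing E v) | ∀ w, localGLPiEquiv E N v g w ∈ congruenceGL N (γ w)} := by
  rw [setOf_forall_mem_congruenceGL_eq_preimage]
  exact (localGLPiEquiv E N v).toHomeomorph.isCompact_preimage.2 (isCompact_univ_pi fun w => isCompact_congruenceGL (γ w))

/-- **a congruence box is OPEN** when all `γ_w ≠ 0` (★ `isOpen_congruenceGL`). [cite: PlatonovRapinchuk1994, §3.3] -/
theorem isOpen_setOf_forall_mem_congruenceGL
    (γ : ∀ w : PlacesOver E v, ValuativeRel.ValueGroupWithZero (w.1.adicCompletion E)) (hγ : ∀ w, γ w ≠ 0) :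
    IsOpen {g : GL (Fin N) (LocalRing E v) | ∀ w, localGLPiEquiv E N v g w ∈ congruenceGL N (γ w)} := by
  rw [setOf_forall_mem_congruenceGL_eq_preimage]
  exact (isOpen_set_pi Set.finite_univ fun w _ => isOpen_congruenceGL (hγ w)).preimage (localGLPiEquiv E N v).continuous

omit [NumberField F] in
/-- **congruence boxes form a neighbourhood basis of `1` in `GL_N(E_v)`**: every neighbourhood of `1` contains a box with all `0 < γ_w < 1`
(★ `exists_congruenceGL_pow_subset` at a uniformiser of each `E_w`, and the product topology along ★ `localGLPiEquiv`).
[cite: PlatonovRapinchuk1994, §3.3] [cite: Casselman1995, Prop. 1.4.4] -/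
theorem exists_forall_mem_congruenceGL_subset {U : Set (GL (Fin N) (LocalRing E v))} (hU : U ∈ 𝓝 (1 : GL (Fin N) (LocalRing E v))) :
    ∃ γ : ∀ w : PlacesOver E v, ValuativeRel.ValueGroupWithZero (w.1.adicCompletion E),
      (∀ w, γ w ≠ 0 ∧ γ w < 1) ∧ ∀ g : GL (Fin N) (LocalRing E v), (∀ w, localGLPiEquiv E N v g w ∈ congruenceGL N (γ w)) → g ∈ U := by
  -- transport the neighbourhood to the product `Π_w GL_N(E_w)`
  have hc : Continuous ((localGLPiEquiv E N v).symm : (∀ w : PlacesOver E v, GL (Fin N) (w.1.adicCompletion E)) → GL (Fin N) (LocalRing E v)) :=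
    map_continuous _
  have h1 : ((localGLPiEquiv E N v).symm : (∀ w : PlacesOver E v, GL (Fin N) (w.1.adicCompletion E)) → GL (Fin N) (LocalRing E v)) 1 = 1 :=
    map_one _
  have hU' : ((localGLPiEquiv E N v).symm : (∀ w : PlacesOver E v, GL (Fin N) (w.1.adicCompletion E)) → GL (Fin N) (LocalRing E v)) ⁻¹' U ∈
      𝓝 (1 : ∀ w : PlacesOver E v, GL (Fin N) (w.1.adicCompletion E)) :=
    hc.continuousAt.preimage_mem_nhds (by rw [h1]; exact hU)
  rw [nhds_pi, Filter.mem_pi] at hU'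
  obtain ⟨I, -, t, ht, hsub⟩ := hU'
  -- a principal congruence subgroup inside each `t w`
  have hw : ∀ w : PlacesOver E v, ∃ γw : ValuativeRel.ValueGroupWithZero (w.1.adicCompletion E),
      γw ≠ 0 ∧ γw < 1 ∧ (congruenceGL N γw : Set (GL (Fin N) (w.1.adicCompletion E))) ⊆ t w := by
    intro w
    obtain ⟨ϖ, hϖ⟩ := exists_isUniformizingElement (F := w.1.adicCompletion E)
    obtain ⟨m, hm, hmU⟩ := exists_congruenceGL_pow_subset (n := N) hϖ (ht w)
    exact ⟨_, pow_ne_zero _ ((Valuation.ne_zero_iff _).mpr hϖ.ne_zero), pow_lt_one₀ zero_le hϖ.valuation_lt_one (by omega), hmU⟩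
  choose γ hγ0 hγ1 hγt using hw
  refine ⟨γ, fun w => ⟨hγ0 w, hγ1 w⟩, fun g hg => ?_⟩
  have hmem : localGLPiEquiv E N v g ∈
      ((localGLPiEquiv E N v).symm : (∀ w : PlacesOver E v, GL (Fin N) (w.1.adicCompletion E)) → GL (Fin N) (LocalRing E v)) ⁻¹' U :=
    hsub (Set.mem_pi.2 fun w _ => hγt w (hg w))
  rw [Set.mem_preimage, ContinuousMulEquiv.symm_apply_apply] at hmem
  exact hmem

end Local

/-! ## §5 The long Weyl element against the big cell `B · N̄` -/

section Weyl

variable {R : Type*} [CommRing R] {N : ℕ}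

/-- entries of the antidiagonal form over `R`: `(Φ_N)_{ij} = [j = rev i]`. [folklore] -/
private theorem stdFormAntidiag_over_apply (i j : Fin N) :
    (StdForm.antidiagonal N).over R i j = if j = i.rev then 1 else 0 := by
  rw [StdForm.over, Matrix.map_apply, StdForm.antidiagonal_J_apply]
  split_ifs <;> simp

/-- **`(Φ_N M Φ_N)_{ij} = M_{rev i, rev j}`** over any commutative ring. [folklore] -/
private theorem stdFormAntidiag_mul_mul_apply (M : Matrix (Fin N) (Fin N) R) (i j : Fin N) :
    ((StdForm.antidiagonal N).over R * M * (StdForm.antidiagonal N).over R) i j = M i.rev j.rev := by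
  rw [Matrix.mul_apply]
  have h1 : ∀ k, ((StdForm.antidiagonal N).over R * M) i k = M i.rev k := fun k => by
    rw [Matrix.mul_apply]
    simp_rw [stdFormAntidiag_over_apply, ite_mul, one_mul, zero_mul]
    rw [Finset.sum_ite_eq' Finset.univ i.rev (fun x => M x k)]
    simp
  simp_rw [h1, stdFormAntidiag_over_apply, mul_ite, mul_one, mul_zero]
  have : ∀ x : Fin N, (j = x.rev) ↔ (x = j.rev) := fun x => by
    constructor <;> intro h <;> rw [h, Fin.rev_rev]
  simp_rw [this]
  rw [Finset.sum_ite_eq' Finset.univ j.rev (fun x => M i.rev x)]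
  simp

variable {w : GL (Fin N) R} (hw : ((w : GL (Fin N) R) : Matrix (Fin N) (Fin N) R) = (StdForm.antidiagonal N).over R)
include hw

/-- **`w² = 1`** for `w` with matrix `Φ_N` (★ `StdForm.over_mul_over`). [cite: Rogawski1990, §1.10 p. 9] -/
theorem mul_self_of_coe_eq_antidiagonal : w * w = 1 :=
  Units.ext (by rw [Units.val_mul, hw, StdForm.over_mul_over, Units.val_one])

/-- `w⁻¹ = w` for `w` with matrix `Φ_N`. [cite: Rogawski1990, §1.10 p. 9] -/
theorem inv_eq_self_of_coe_eq_antidiagonal : w⁻¹ = w :=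
  inv_eq_of_mul_eq_one_right (mul_self_of_coe_eq_antidiagonal hw)

/-- **`w u w⁻¹` is LOWER unitriangular for `u` UPPER unitriangular** (`(w u w)_{ij} = u_{rev i, rev j}`). [cite: Casselman1995, §6.3] -/
theorem conj_mem_lower_of_mem_upperUnitriangular {u : GL (Fin N) R} (hu : u ∈ upperUnitriangular (Fin N) R) :
    w * u * w⁻¹ ∈ unipotentRadicalGL R (⇑toDual ∘ (_root_.id : Fin N → Fin N)) := by
  rw [inv_eq_self_of_coe_eq_antidiagonal hw, mem_unipotentRadicalGL_iff_apply]
  obtain ⟨htri, hdiag⟩ := (mem_upperUnitriangular_iff u).1 hu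
  intro i j hij
  change toDual j ≤ toDual i at hij
  rw [toDual_le_toDual] at hij
  rw [Units.val_mul, Units.val_mul, hw, stdFormAntidiag_mul_mul_apply]
  rcases hij.lt_or_eq with hlt | heq
  · rw [htri (show _root_.id j.rev < _root_.id i.rev from Fin.rev_lt_rev.2 hlt), Matrix.one_apply_ne (ne_of_lt hlt)]
  · subst heq
    rw [hdiag, Matrix.one_apply_eq]

/-- **`w ∉ B · N̄` for `N ≥ 2`**: no upper triangular `b` and lower unitriangular `m` have `b m = w⁻¹` — compare the `(N−1, N−1)` entries:
`(b m)_{ℓℓ} = b_{ℓℓ}` is a unit (times `(b⁻¹)_{ℓℓ}` it gives `1`) while `(w)_{ℓℓ} = 0`. [cite: Casselman1995, Prop. 1.3.1 and §6.3] -/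
theorem borel_mul_lower_ne_inv_of_coe_eq_antidiagonal [Nontrivial R] (hN : 2 ≤ N) {b m : GL (Fin N) R}
    (hb : b ∈ standardParabolicGL R (_root_.id : Fin N → Fin N))
    (hm : m ∈ unipotentRadicalGL R (⇑toDual ∘ (_root_.id : Fin N → Fin N))) : b * m ≠ w⁻¹ := by
  intro h
  obtain ⟨ℓ, hℓ⟩ : ∃ ℓ : Fin N, ℓ.val = N - 1 := ⟨⟨N - 1, by omega⟩, rfl⟩
  have hlast : ∀ k : Fin N, k ≤ ℓ := fun k => Fin.le_def.2 (by have := k.2; omega)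
  have hbtri := (mem_standardParabolicGL_iff (_root_.id : Fin N → Fin N) b).1 hb
  have hm' := (mem_unipotentRadicalGL_iff_apply m).1 hm
  -- `(b m)_{ℓℓ} = b_{ℓℓ}`
  have h1 : ((b * m : GL (Fin N) R) : Matrix (Fin N) (Fin N) R) ℓ ℓ = (b : Matrix (Fin N) (Fin N) R) ℓ ℓ := by
    rw [Units.val_mul, Matrix.mul_apply, Finset.sum_eq_single ℓ]
    · rw [hm' ℓ ℓ le_rfl, Matrix.one_apply_eq, mul_one]
    · intro k _ hk
      rw [hbtri (show _root_.id k < _root_.id ℓ from lt_of_le_of_ne (hlast k) hk), zero_mul]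
    · intro h; exact absurd (Finset.mem_univ ℓ) h
  -- `(w⁻¹)_{ℓℓ} = 0`
  have h2 : ((w⁻¹ : GL (Fin N) R) : Matrix (Fin N) (Fin N) R) ℓ ℓ = 0 := by
    rw [inv_eq_self_of_coe_eq_antidiagonal hw, hw, stdFormAntidiag_over_apply, if_neg]
    intro hℓℓ
    have h' := congrArg Fin.val hℓℓ
    rw [Fin.val_rev] at h'
    omega
  -- `b_{ℓℓ} (b⁻¹)_{ℓℓ} = 1`
  have hbinv := (mem_standardParabolicGL_iff (_root_.id : Fin N → Fin N) b⁻¹).1 (Subgroup.inv_mem _ hb)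
  have h3 : (b : Matrix (Fin N) (Fin N) R) ℓ ℓ * ((b⁻¹ : GL (Fin N) R) : Matrix (Fin N) (Fin N) R) ℓ ℓ = 1 := by
    have h : ((b * b⁻¹ : GL (Fin N) R) : Matrix (Fin N) (Fin N) R) ℓ ℓ = (1 : Matrix (Fin N) (Fin N) R) ℓ ℓ := by
      rw [mul_inv_cancel, Units.val_one]
    rw [Matrix.one_apply_eq, Units.val_mul, Matrix.mul_apply, Finset.sum_eq_single ℓ] at h
    · exact h
    · intro k _ hk
      rw [hbtri (show _root_.id k < _root_.id ℓ from lt_of_le_of_ne (hlast k) hk), zero_mul]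
    · intro h'; exact absurd (Finset.mem_univ ℓ) h'
  rw [← h1, h, h2, zero_mul] at h3
  exact zero_ne_one h3

end Weyl

end UnitaryGroup

end Literature.NumberTheory.Automorphic

end
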